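import Literature.AnabelianGeometry.EtaleTheta.Discharge.Sec2Cor218ivAllLevels
import Literature.AnabelianGeometry.EtaleTheta.Discharge.Sec2TowerOfSettingCorollaries
import Literature.AnabelianGeometry.SemiGraphs.TemperedCurveBridge
import HarnessLib

/-!
# [EtTh] Cor. 2.18 (ii), (iii) in `ThetaEnvData` currency: over a bare `ThetaEnvData`, at the levels of
# a `ThetaEnvTower`, and AT THE §1 MODEL of `X̲̲` (proof-only)

Mochizuki, *The Étale Theta Function and its Frobenioid-theoretic Manifestations* [EtTh], Publ. RIMS
**45** (2009), §2, Cor. 2.18 (ii) p.60, Cor. 2.18 (iii) p.61, Prop. 2.11 (ii) p.44, Cor. 2.19 (ii) p.64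
(locators `p.N` = PDF pages of the PRIMS text; bib key `MochizukiEtTh2009`). PROOF-ONLY companion (no
`def`, no new named fact; cell `abc-iut`, seat abc-iut-f-150, FACT-LIST tranche 150) of seat
abc-iut-L2-d1's `ThetaRigidityLevels.lean`, which restates the named facts `RigidData.Cor218_ii`,
`.Cor218_iii_PiX`, `.Cor218_iii_quotient` of `ThetaRigidity.lean` VERBATIM over a bare
`T : ThetaEnvData N` (FROZEN FACT-LIST rows F-0635 `ThetaEnvData.Cor218_ii`, F-0636
`ThetaEnvData.Cor218_iii_PiX`, F-0637 `ThetaEnvData.Cor218_iii_quotient`).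

These rows are SCHEMAS over a lawless interface (R5): consumable AT A NAMED INSTANCE only. This file
supplies the INSTANCE FORMS the cone consumes, in the `ThetaEnvData` currency of the consumers:

* §1 (generic, any `T : ThetaEnvData N`): `ThetaEnvData.cor218_iii_PiX_of_tempSlim`,
  `ThetaEnvData.cor218_iii_quotient_of_slimY` / `_of_tempSlim` — both Cor. 2.18 (iii) clauses from
  temp-slimness of `Π^tp_X` ("every open subgroup has trivial centraliser", [SemiAnbd] Ex. 3.10; the
  quotient clause is Prop. 2.11 (ii), abc-iut-L2-t2's `centralizerUnion_cycEnvelope_eq`; that it needs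
  exactly temp-slimness of `Π^tp_Y` is abc-iut-f-147's `ThetaEnvData.centralizerUnion_env_eq_ker_iff_slim`,
  `Sec2Cor218QuotientFibreIff.lean`); and, for a
  tower `T : ThetaEnvTower E`, `ThetaEnvTower.level_cor218_iii_PiX_of_tempSlim` /
  `level_cor218_iii_quotient_of_tempSlim` — literally the binders `hP` / `hq` of abc-iut-L2-d1's
  `ThetaEnvTower.cor219_ii_of_levels` and of abc-iut-L2-t2's `cor218_iv_bijective_of_odd_of_levels`.
* §2 (the §1 MODEL, abc-iut-L2-t8's `DoubleUnderline.thetaEnvData μ hC hS` / `thetaEnvTower τ hC hS`):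
  - `thetaEnvData_cor218_iii_PiX`, `thetaEnvData_cor218_iii_quotient` (+ `_of_groupLevelData` twins
    with `Π^tp_X` temp-slim supplied by the §6 parameter bundle `TemperedCurve.GroupLevelData`) and the
    tower-level twins `thetaEnvTower_level_cor218_iii_PiX`, `thetaEnvTower_level_cor218_iii_quotient`,
    from temp-slimness of `Π^tp_X` (`hslimX : IsSlimGroup D.PiTemp`, restricted to `Π^tp_X̲̲` by
    abc-iut-L2-d1's `tempSlim_Huu`) — the binders `hP`/`hq` of `cor218_iv_bijective_of_odd_of_model`
    (`Sec2TowerOfSettingCorollaries.lean`); the `RigidData`-currency twins for abc-iut-L2-t8's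
    `rigidData` (rows F-0622/F-0623 at the named instance) are abc-iut-f-147's
    `rigidData_cor218_iii_of_isSlimGroup` / `rigidData_cor218_iii_quotient_of_isSlimGroup`
    (`Sec2Cor218QuotientFibreIff.lean`), not restated here;
  - `thetaEnvData_cor218_ii_of_H2` (+ `_of_odd`), `thetaEnvTower_level_cor218_ii` (every chain level
    `M ∈ E`), `thetaEnvData_cor218_ii_modAll` (every `M ∈ ℕ≥1`) — Cor. 2.18 (ii) for the model in
    `ThetaEnvData` currency, from abc-iut-L2-t10's `cor218_ii_of_model` (⟸ Prop. 2.14 (ii) for the model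
    ⟸ the named §1 facts `Prop15ii`, `Prop15iii` = [EtTh] Prop. 1.5 (ii), (iii), the printed dependency
    "cf. Proposition 1.5, (ii), (iii)", p.49); the `2`-torsion binder `H2` dies along a `CyclotomeTower`
    (abc-iut-L2-t8's `CyclotomeTower.red_eq_one_of_sq_eq_one`). These are the binder `hT` of layer L6's
    `isMonoThetaEnv_iff_ofDoubleUnderline` (`Literature.IUT.HodgeArakelov.MonoThetaCyclotomesBridgeEtTh`)
    and the binder `h218ii` of abc-iut-L2-d1's `exists_iso_of_systems_model`;
  - capstones with these binders SUPPLIED: `cor218_iv_bijective_of_odd_of_model_of_slim` (Cor. 2.18 (iv)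
    odd-bijectivity for the model tower, residual: `haugOpen` and the level-wise first half of
    Cor. 2.18 (iv)); `exists_iso_of_systems_model_of_prop15` and `exists_iso_of_systems_model_of_facts`
    (Cor. 2.19 (ii), STRONG form — every projective system of mono-theta environments of `X̲̲` is
    isomorphic, compatibly with the reductions, to the natural system of ANY compatible family of theta
    cocycles — modulo exactly the fact set of abc-iut-L2-d1's `cor219_ii_model_of_facts`).

READING of the cusp labels in `thetaEnvData_cor218_ii_of_H2`: abc-iut-L2-t10's `cor218_ii_of_model`
is stated for ANY `RigidData` over the model's `ThetaEnvData`; Cor. 2.18 (ii) does not involve the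
labelled cusps (Cor. 2.9), which `RigidData` carries as INPUT DATA (`CuspLabels`), so inside the proof
the rigidity data are taken with the empty labelling — the STATEMENT is label-free, and for any
`L : C.CuspLabels` it is abc-iut-L2-t10's `rigidData_cor218_ii_of_H2` read through
`RigidData.cor218_ii_iff`.

HONEST FRAMING: kernel-checked reductions to named inputs; the hypotheses (`IsSlimGroup D.PiTemp`,
`Prop15ii`, `Prop15iii`, `IsOpenMap D.aug`, Cor. 2.18 (i) at the chain levels, `ThetaEnvTower.Cor219_iii`,
`IsEtThOrigin`, `hYcl`) are not asserted; the universal closures of F-0636/F-0637 are FALSE over the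
lawless interface (seat abc-iut-w5-d175's `RigidData.Toy.not_forall_cor218_iii_PiX` /
`not_forall_cor218_iii_quotient` read through `RigidData.cor218_iii_PiX_iff` / `cor218_iii_quotient_iff`;
kernel record: seat abc-iut-w5-d071) — a refuted closure says nothing about [EtTh] (a refereed paper)
nor about the model, where the rows are the theorems of §2; no side is taken on [IUTchIII] Cor. 3.12;
typed ≠ proved elsewhere.
-/

noncomputable section

namespace Literature.AnabelianGeometry.EtaleTheta

open Literature.AnabelianGeometry.SemiGraphs
open Literature.AlgebraicGeometry.Frobenioids (IsSlimGroup)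

universe u

/-! ## §1. Cor. 2.18 (iii) over a bare `ThetaEnvData` and at the levels of a `ThetaEnvTower` -/

namespace ThetaEnvData

variable {N : ℕ+} (T : ThetaEnvData.{u} N)

/-- **Cor. 2.18 (iii), second part (`Π•_X ≅ Π^tp_X`: the conjugation action `Π^tp_X → Aut(Π^tp_Y)` is
faithful), for ANY `ThetaEnvData`, from temp-slimness of `Π^tp_X`** ([SemiAnbd] Ex. 3.10: every open
subgroup — here `Π^tp_Y` — has trivial centraliser). FACT-LIST F-0636 at an arbitrary instance, modulo
the named input. [cite: MochizukiEtTh2009, Cor 2.18(iii) p.61] -/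
theorem cor218_iii_PiX_of_tempSlim
    (hts : ∀ U : Subgroup T.PiX, IsOpen (U : Set T.PiX) →
      ∀ z : T.PiX, (∀ u ∈ U, z * u = u * z) → z = 1) :
    T.Cor218_iii_PiX := fun x hx =>
  hts T.PiY T.PiY_open x fun u hu => by
    have h := hx ⟨u, hu⟩
    change x * u * x⁻¹ = u at h
    calc x * u = x * u * x⁻¹ * x := by group
      _ = u * x := by rw [h]

/-- Temp-slimness of `Π^tp_X` restricts to its open subgroup `Π^tp_Y` (an open subgroup of `Π^tp_Y` is
open in `Π^tp_X`). [cite: MochizukiEtTh2009, Prop 2.11(ii) p.44] -/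
theorem tempSlim_PiY
    (hts : ∀ U : Subgroup T.PiX, IsOpen (U : Set T.PiX) →
      ∀ z : T.PiX, (∀ u ∈ U, z * u = u * z) → z = 1) :
    ∀ U : Subgroup T.PiY, IsOpen (U : Set T.PiY) →
      ∀ z : T.PiY, (∀ u ∈ U, z * u = u * z) → z = 1 := by
  intro U hU z hz
  have hUo : IsOpen ((U.map T.PiY.subtype : Subgroup T.PiX) : Set T.PiX) := by
    rw [Subgroup.coe_map]
    exact T.PiY_open.isOpenEmbedding_subtypeVal.isOpenMap _ hU
  exact Subtype.ext (hts _ hUo z (by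
    rintro _ ⟨u, hu, rfl⟩
    exact congrArg Subtype.val (hz u hu)))

/-- **Cor. 2.18 (iii), first part (the quotient `Π• ↠ Π•_Y` is group-theoretic: its kernel is the union
of the centralisers of the open subgroups), for ANY `ThetaEnvData` with temp-slim `Π^tp_Y`** — Prop. 2.11
(ii) (abc-iut-L2-t2's `centralizerUnion_cycEnvelope_eq`; the continuity input is the interface axiom
`chi_ker_open`). [cite: MochizukiEtTh2009, Cor 2.18(iii) p.61] -/
theorem cor218_iii_quotient_of_slimY
    (hslim : ∀ U : Subgroup T.PiY, IsOpen (U : Set T.PiY) →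
      ∀ z : T.PiY, (∀ u ∈ U, z * u = u * z) → z = 1) :
    T.Cor218_iii_quotient := by
  refine centralizerUnion_cycEnvelope_eq T.augY T.chi hslim ?_
  have h : (((T.chi.comp T.augY).ker : Subgroup T.PiY) : Set T.PiY) =
      Subtype.val ⁻¹' (((T.chi.comp T.aug).ker : Subgroup T.PiX) : Set T.PiX) := by
    ext g; simp [MonoidHom.mem_ker]
  rw [h]
  exact T.chi_ker_open.preimage continuous_subtype_val

/-- **Cor. 2.18 (iii), first part, for ANY `ThetaEnvData`, from temp-slimness of `Π^tp_X`.**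
FACT-LIST F-0637 at an arbitrary instance, modulo the named input.
[cite: MochizukiEtTh2009, Cor 2.18(iii) p.61] -/
theorem cor218_iii_quotient_of_tempSlim
    (hts : ∀ U : Subgroup T.PiX, IsOpen (U : Set T.PiX) →
      ∀ z : T.PiX, (∀ u ∈ U, z * u = u * z) → z = 1) :
    T.Cor218_iii_quotient :=
  T.cor218_iii_quotient_of_slimY (T.tempSlim_PiY hts)

/-- **Cor. 2.18 (iii), both clauses, for ANY `ThetaEnvData`, from temp-slimness of `Π^tp_X`** (the
`ThetaEnvData`-level twin of abc-iut-L2-d1's `RigidData.cor218_iii_of_tempSlim`).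
[cite: MochizukiEtTh2009, Cor 2.18(iii) p.61] -/
theorem cor218_iii_of_tempSlim
    (hts : ∀ U : Subgroup T.PiX, IsOpen (U : Set T.PiX) →
      ∀ z : T.PiX, (∀ u ∈ U, z * u = u * z) → z = 1) :
    T.Cor218_iii_PiX ∧ T.Cor218_iii_quotient :=
  ⟨T.cor218_iii_PiX_of_tempSlim hts, T.cor218_iii_quotient_of_tempSlim hts⟩

end ThetaEnvData

namespace ThetaEnvTower

variable {E : Set ℕ+} (T : ThetaEnvTower.{u} E)

/-- **Cor. 2.18 (iii), second part, at every level of a `ThetaEnvTower` with temp-slim `Π^tp_X`** —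
the binder `hP` of `cor219_ii_of_levels` / `cor218_iv_bijective_of_odd_of_levels`.
[cite: MochizukiEtTh2009, Cor 2.18(iii) p.61] -/
theorem level_cor218_iii_PiX_of_tempSlim
    (hts : ∀ U : Subgroup T.PiX, IsOpen (U : Set T.PiX) →
      ∀ z : T.PiX, (∀ u ∈ U, z * u = u * z) → z = 1) (M : E) :
    (T.level M).Cor218_iii_PiX :=
  (T.level M).cor218_iii_PiX_of_tempSlim hts

/-- **Cor. 2.18 (iii), first part, at every level of a `ThetaEnvTower` with temp-slim `Π^tp_X`** —
the binder `hq` of `cor219_ii_of_levels` / `cor218_iv_bijective_of_odd_of_levels`.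
[cite: MochizukiEtTh2009, Cor 2.18(iii) p.61] -/
theorem level_cor218_iii_quotient_of_tempSlim
    (hts : ∀ U : Subgroup T.PiX, IsOpen (U : Set T.PiX) →
      ∀ z : T.PiX, (∀ u ∈ U, z * u = u * z) → z = 1) (M : E) :
    (T.level M).Cor218_iii_quotient :=
  (T.level M).cor218_iii_quotient_of_tempSlim hts

end ThetaEnvTower

/-! ## §2. At the §1 model of `X̲̲` -/

namespace ThetaSetting.EtaleThetaData.DoubleUnderline

variable {p : ℕ} [Fact p.Prime] {D : ThetaSetting p} {E : D.EtaleThetaData} {l : ℕ}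
  (C : E.DoubleUnderline l) {N : ℕ+} (μ : D.CyclotomeMod l N) {Es : Set ℕ+}
  (τ : D.CyclotomeTower l Es)

/-! ### Cor. 2.18 (iii) for the model, from temp-slimness of `Π^tp_X` -/

/-- **Cor. 2.18 (iii), second part, FOR THE §1 MODEL** at level `μ`, in `ThetaEnvData` currency:
`(C.thetaEnvData μ hC hS).Cor218_iii_PiX` ⟸ temp-slimness of `Π^tp_X` (`IsSlimGroup`, [SemiAnbd]
Ex. 3.10, restricted to `Π^tp_X̲̲` by `tempSlim_Huu`). FACT-LIST F-0636 at the named instance.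
[cite: MochizukiEtTh2009, Cor 2.18(iii) p.61] -/
theorem thetaEnvData_cor218_iii_PiX (hC : D.Compat) (hS : D.Sec2Hyps) (hslimX : IsSlimGroup D.PiTemp) :
    (C.thetaEnvData μ hC hS).Cor218_iii_PiX :=
  (C.thetaEnvData μ hC hS).cor218_iii_PiX_of_tempSlim (C.tempSlim_Huu hslimX)

/-- **Cor. 2.18 (iii), first part, FOR THE §1 MODEL** at level `μ`, in `ThetaEnvData` currency:
`(C.thetaEnvData μ hC hS).Cor218_iii_quotient` ⟸ temp-slimness of `Π^tp_X`. FACT-LIST F-0637 at the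
named instance. [cite: MochizukiEtTh2009, Cor 2.18(iii) p.61] -/
theorem thetaEnvData_cor218_iii_quotient (hC : D.Compat) (hS : D.Sec2Hyps)
    (hslimX : IsSlimGroup D.PiTemp) :
    (C.thetaEnvData μ hC hS).Cor218_iii_quotient :=
  (C.thetaEnvData μ hC hS).cor218_iii_quotient_of_tempSlim (C.tempSlim_Huu hslimX)

/-- **Cor. 2.18 (iii), both parts, FOR THE §1 MODEL** at level `μ` in `ThetaEnvData` currency, with
`Π^tp_X` temp-slim supplied by the §6 parameter bundle `d : TemperedCurve.GroupLevelData` (its field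
`isSlimGroup`; abc-iut-L3-lead ruling η′: a parameter, not a fact).
[cite: MochizukiEtTh2009, Cor 2.18(iii) p.61] -/
theorem thetaEnvData_cor218_iii_of_groupLevelData (d : D.toTemperedCurve.GroupLevelData)
    (hC : D.Compat) (hS : D.Sec2Hyps) :
    (C.thetaEnvData μ hC hS).Cor218_iii_PiX ∧ (C.thetaEnvData μ hC hS).Cor218_iii_quotient :=
  ⟨C.thetaEnvData_cor218_iii_PiX μ hC hS d.isSlimGroup,
    C.thetaEnvData_cor218_iii_quotient μ hC hS d.isSlimGroup⟩

/-- **Cor. 2.18 (iii), second part, at every level `M ∈ E` of the model tower** — the binder `hP` of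
`cor218_iv_bijective_of_odd_of_model`. [cite: MochizukiEtTh2009, Cor 2.18(iii) p.61] -/
theorem thetaEnvTower_level_cor218_iii_PiX (hC : D.Compat) (hS : D.Sec2Hyps)
    (hslimX : IsSlimGroup D.PiTemp) (M : Es) :
    ((C.thetaEnvTower τ hC hS).level M).Cor218_iii_PiX :=
  (C.thetaEnvTower τ hC hS).level_cor218_iii_PiX_of_tempSlim (C.tempSlim_Huu hslimX) M

/-- **Cor. 2.18 (iii), first part, at every level `M ∈ E` of the model tower** — the binder `hq` of
`cor218_iv_bijective_of_odd_of_model`. [cite: MochizukiEtTh2009, Cor 2.18(iii) p.61] -/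
theorem thetaEnvTower_level_cor218_iii_quotient (hC : D.Compat) (hS : D.Sec2Hyps)
    (hslimX : IsSlimGroup D.PiTemp) (M : Es) :
    ((C.thetaEnvTower τ hC hS).level M).Cor218_iii_quotient :=
  (C.thetaEnvTower τ hC hS).level_cor218_iii_quotient_of_tempSlim (C.tempSlim_Huu hslimX) M

/-! ### Cor. 2.18 (ii) for the model, from Prop. 1.5 (ii), (iii) -/

/-- **Cor. 2.18 (ii) FOR THE §1 MODEL at level `μ`, in `ThetaEnvData` currency**:
`(C.thetaEnvData μ hC hS).Cor218_ii` ⟸ Prop. 1.5 (ii), (iii) (named facts `Prop15ii`, `Prop15iii`) and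
the `2`-torsion binder `H2` — abc-iut-L2-t10's `cor218_ii_of_model`, applied to abc-iut-L2-t8's
`rigidData` with the (irrelevant) cusp labels instantiated by the empty labelling. The binder `hT` of
layer L6's `isMonoThetaEnv_iff_ofDoubleUnderline`. FACT-LIST F-0635 at the named instance.
[cite: MochizukiEtTh2009, Cor 2.18(ii) p.60] -/
theorem thetaEnvData_cor218_ii_of_H2 (hC : D.Compat) (hS : D.Sec2Hyps) (h15 : Prop15iii E hC)
    (h15ii : Prop15ii E.toKummerData hC) (H2 : ∀ t : D.lDeltaTheta l, t ^ 2 = 1 → μ.red t = 1) :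
    (C.thetaEnvData μ hC hS).Cor218_ii :=
  (RigidData.cor218_ii_iff _).1
    (C.cor218_ii_of_model μ hC hS h15 h15ii H2
      (C.rigidData μ hC hS h15 ⟨fun _ => ∅, fun _ => ∅, fun _ => rfl⟩) rfl)

/-- **Cor. 2.18 (ii) FOR THE §1 MODEL at an ODD level `N`**, in `ThetaEnvData` currency, conditional
only on Prop. 1.5 (ii), (iii) (`H2` is automatic for odd `N`). [cite: MochizukiEtTh2009, Cor 2.18(ii) p.60] -/
theorem thetaEnvData_cor218_ii_of_odd (hC : D.Compat) (hS : D.Sec2Hyps) (h15 : Prop15iii E hC)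
    (h15ii : Prop15ii E.toKummerData hC) (hN : Odd (N : ℕ)) :
    (C.thetaEnvData μ hC hS).Cor218_ii :=
  C.thetaEnvData_cor218_ii_of_H2 μ hC hS h15 h15ii (red_eq_one_of_sq_eq_one_of_odd μ hN)

/-- **Cor. 2.18 (ii) at every level `M ∈ E` of the model tower**, in `ThetaEnvData` currency,
conditional only on Prop. 1.5 (ii), (iii) (`H2` dies along the tower,
`CyclotomeTower.red_eq_one_of_sq_eq_one`) — the binder `h218ii` of abc-iut-L2-d1's
`exists_iso_of_systems_model`. [cite: MochizukiEtTh2009, Cor 2.18(ii) p.60] -/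
theorem thetaEnvTower_level_cor218_ii (hC : D.Compat) (hS : D.Sec2Hyps) (h15 : Prop15iii E hC)
    (h15ii : Prop15ii E.toKummerData hC) (M : Es) :
    ((C.thetaEnvTower τ hC hS).level M).Cor218_ii :=
  C.thetaEnvData_cor218_ii_of_H2 (τ.mod M) hC hS h15 h15ii (τ.red_eq_one_of_sq_eq_one M)

/-- **Cor. 2.18 (ii) at EVERY level `M ∈ ℕ≥1` of the model** (identification `τ.modAll M` of
abc-iut-w4-d024's `CyclotomeTowerAllLevels`), in `ThetaEnvData` currency, conditional only on Prop. 1.5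
(ii), (iii). [cite: MochizukiEtTh2009, Cor 2.18(ii) p.60] -/
theorem thetaEnvData_cor218_ii_modAll (hC : D.Compat) (hS : D.Sec2Hyps) (h15 : Prop15iii E hC)
    (h15ii : Prop15ii E.toKummerData hC) (M : ℕ+) :
    (C.thetaEnvData (τ.modAll M) hC hS).Cor218_ii :=
  C.thetaEnvData_cor218_ii_of_H2 (τ.modAll M) hC hS h15 h15ii (modAll_red_eq_one_of_sq_eq_one τ M)

/-! ### Capstones with the Cor. 2.18 (ii)/(iii) binders supplied -/

/-- **Cor. 2.18 (iv), "[hence a bijection if `N/M` is odd]", FOR THE §1 MODEL TOWER** with BOTH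
Cor. 2.18 (iii) inputs and the reduction clause supplied: residual inputs are temp-slimness of `Π^tp_X`,
openness of `Π^tp_X → G_K` (`haugOpen`, for abc-iut-L2-d1's `cor218_iv_reduction_model`) and the
level-wise first half of Cor. 2.18 (iv) (`Cor218_iv_surjective`, `Cor218_iv_fibre`).
[cite: MochizukiEtTh2009, Cor 2.18(iv) p.62] -/
theorem cor218_iv_bijective_of_odd_of_model_of_slim (hC : D.Compat) (hS : D.Sec2Hyps)
    (hslimX : IsSlimGroup D.PiTemp) (haugOpen : IsOpenMap D.aug)
    (hlift : ∀ M : Es, ((C.thetaEnvTower τ hC hS).level M).Cor218_iv_surjective)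
    (hfib : ∀ M : Es, ((C.thetaEnvTower τ hC hS).level M).Cor218_iv_fibre) :
    (C.thetaEnvTower τ hC hS).Cor218_iv_bijective_of_odd :=
  C.cor218_iv_bijective_of_odd_of_model τ hC hS
    (C.thetaEnvTower_level_cor218_iii_PiX τ hC hS hslimX)
    (C.thetaEnvTower_level_cor218_iii_quotient τ hC hS hslimX) hlift hfib
    (C.cor218_iv_reduction_model τ hC hS hslimX haugOpen)

/-- **Cor. 2.19 (ii), strong form, FOR THE §1 MODEL TOWER, Cor. 2.18 (ii) supplied**: any projective
system of mono-theta environments of `X̲̲` is isomorphic, compatibly with the reductions, to the natural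
system of ANY compatible family of theta cocycles `η₀` — abc-iut-L2-d1's `exists_iso_of_systems_model`
with its binder `h218ii` DISCHARGED by Prop. 1.5 (ii), (iii); residual inputs: temp-slimness of
`Π^tp_X`, `haugOpen`, and the level-wise first half of Cor. 2.18 (iv).
[cite: MochizukiEtTh2009, Cor 2.19(ii) p.64] -/
theorem exists_iso_of_systems_model_of_prop15 (hC : D.Compat) (hS : D.Sec2Hyps)
    (h15 : Prop15iii E hC) (h15ii : Prop15ii E.toKummerData hC) (hslimX : IsSlimGroup D.PiTemp)
    (haugOpen : IsOpenMap D.aug)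
    (hlift : ∀ M : Es, ((C.thetaEnvTower τ hC hS).level M).Cor218_iv_surjective)
    (hfib : ∀ M : Es, ((C.thetaEnvTower τ hC hS).level M).Cor218_iv_fibre)
    (S : (C.thetaEnvTower τ hC hS).MTESystem)
    (η₀ : ∀ M : Es, (C.thetaEnvTower τ hC hS).PiYdd → (C.thetaEnvTower τ hC hS).mu M)
    (hη₀ : ∀ M, η₀ M ∈ (C.thetaEnvTower τ hC hS).thetaCocycles M)
    (hη₀c : ∀ (M M' : Es) (h : (M : ℕ+) ∣ M'), (C.thetaEnvTower τ hC hS).red M M' h ∘ η₀ M' = η₀ M) :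
    ∃ α : ∀ M : Es, (((C.thetaEnvTower τ hC hS).level M).modelMono (hη₀ M)).Iso
        (((C.thetaEnvTower τ hC hS).level M).modelMono (S.mem M)),
      ∀ (M M' : Es) (h : (M : ℕ+) ∣ M') (x : ((C.thetaEnvTower τ hC hS).level M').env),
        S.a M M' h ((C.thetaEnvTower τ hC hS).redEnv M M' h ((α M').e x)) =
          (α M).e ((C.thetaEnvTower τ hC hS).redEnv M M' h x) :=
  C.exists_iso_of_systems_model τ hC hS hslimX haugOpen hlift hfib
    (C.thetaEnvTower_level_cor218_ii τ hC hS h15 h15ii) S η₀ hη₀ hη₀c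

/-- **Cor. 2.19 (ii), strong form, FOR THE §1 MODEL TOWER, modulo FACT-policy inputs only** — the
strong-form twin of abc-iut-L2-d1's `cor219_ii_model_of_facts`, with the SAME inputs: Prop. 1.5 (ii),
(iii); temp-slimness of `Π^tp_X`; `haugOpen`; Cor. 2.18 (i) for the instantiated rigidity data at the
chain levels (FACT-policy); constant multiple rigidity as the named fact `ThetaEnvTower.Cor219_iii`;
the §1 origin hypotheses `IsEtThOrigin`, `hYcl` (through abc-iut-L5-t14's `rigidData_prop214_i` and
abc-iut-L2-t8's `dtpYTheta_comm`). The level-wise Cor. 2.18 (iv) surjectivity is abc-iut-L2-t10's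
`rigidData_cor218_iv_surjective` (+ abc-iut-L2-d1's `hcoll_of_cor219_iii`), the fibre clause its
`cor218_iv_fibre_of_prop214_i`, and Cor. 2.18 (ii) is `thetaEnvTower_level_cor218_ii`.
[cite: MochizukiEtTh2009, Cor 2.19(ii) p.64] -/
theorem exists_iso_of_systems_model_of_facts (hC : D.Compat) (hS : D.Sec2Hyps)
    (h15 : Prop15iii E hC) (h15ii : Prop15ii E.toKummerData hC) (L : C.CuspLabels)
    (hslimX : IsSlimGroup D.PiTemp) (haugOpen : IsOpenMap D.aug)
    (h218i : ∀ M : Es, (C.rigidData (τ.mod M) hC hS h15 L).Cor218_i)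
    (h219iii : (C.thetaEnvTower τ hC hS).Cor219_iii) (hO : D.IsEtThOrigin)
    (hYcl : (D.DtpY.map D.toHat.toMonoidHom).topologicalClosure ≤
      D.DtpY.map D.toHat.toMonoidHom ⊔ (⁅⁅D.DeltaHat, D.DeltaHat⁆, D.DeltaHat⁆).topologicalClosure)
    (S : (C.thetaEnvTower τ hC hS).MTESystem)
    (η₀ : ∀ M : Es, (C.thetaEnvTower τ hC hS).PiYdd → (C.thetaEnvTower τ hC hS).mu M)
    (hη₀ : ∀ M, η₀ M ∈ (C.thetaEnvTower τ hC hS).thetaCocycles M)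
    (hη₀c : ∀ (M M' : Es) (h : (M : ℕ+) ∣ M'), (C.thetaEnvTower τ hC hS).red M M' h ∘ η₀ M' = η₀ M) :
    ∃ α : ∀ M : Es, (((C.thetaEnvTower τ hC hS).level M).modelMono (hη₀ M)).Iso
        (((C.thetaEnvTower τ hC hS).level M).modelMono (S.mem M)),
      ∀ (M M' : Es) (h : (M : ℕ+) ∣ M') (x : ((C.thetaEnvTower τ hC hS).level M').env),
        S.a M M' h ((C.thetaEnvTower τ hC hS).redEnv M M' h ((α M').e x)) =
          (α M).e ((C.thetaEnvTower τ hC hS).redEnv M M' h x) :=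
  C.exists_iso_of_systems_model_of_prop15 τ hC hS h15 h15ii hslimX haugOpen
    (fun M => (RigidData.cor218_iv_surjective_iff _).1
      (C.rigidData_cor218_iv_surjective τ M hC hS h15 h15ii L _ rfl (h218i M)
        (C.hcoll_of_cor219_iii τ hC hS h15 L h218i h219iii M)))
    (fun M => (RigidData.cor218_iv_fibre_iff _).1
      ((C.rigidData (τ.mod M) hC hS h15 L).cor218_iv_fibre_of_prop214_i
        (C.rigidData_prop214_i (τ.mod M) hC hS h15 L hO (D.dtpYTheta_comm hO) hYcl)))
    S η₀ hη₀ hη₀c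

end ThetaSetting.EtaleThetaData.DoubleUnderline

end Literature.AnabelianGeometry.EtaleTheta

end
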